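import Mathlib.Analysis.InnerProductSpace.PiL2

/-!
# FrustratedLawDichotomy · residual crux `AperiodicFrustratedLawGap` (stmt-AtomisticToContinuum-27623) — HOST-WINDOW EQUILIBRIUM BY SYMMETRY (T2 ingredient, host-agnostic)
# (hdef side, class A: the `Σ_{window} g(n_p - n_q) = 0` row of the window flattening; decomp-a2c lens-5 g111 NODE-11)

In T2 the force balance `Σ_q g(p - q) = 0` of a coherent root is linearised around the host sites `n`; the zeroth-order term is the host's own window force
`Σ_{w ∈ W} g w` over the finite window `W = {n_p - n_q}` of host bond vectors.  It VANISHES by symmetry, with no lattice sum and no summability: for a Bravais host (fcc)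
the ball window is inversion-symmetric and `g` is odd; for hcp (not Bravais) the site point group `D3h ∋ C₃, σ_h` has trivial joint fixed space and `g x = ψ(‖x‖²) • x`
is equivariant under linear isometries.  This file proves exactly that, DEF-FREE and Mathlib-only:

* `sum_comp_eq_sum_of_mapsTo_injOn` — a self-map of a finset that maps it into itself injectively permutes it: `Σ_{w∈W} f (A w) = Σ_{w∈W} f w`;
* `sum_eq_zero_of_equivariant_family` — if a family of additive maps `A i` each permutes `W`, `g` is equivariant on `W` (`g (A i w) = A i (g w)`), and the joint fixed space
  of the family is trivial, then `Σ_{w∈W} g w = 0`;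
* `sum_eq_zero_of_neg_mem` — the inversion case: `W = -W`, `g` odd on `W` ⇒ `Σ_W g = 0` (real vector space);
* `radial_smul_equivariant` — `(c ‖A x‖²) • A x = A ((c ‖x‖²) • x)` for a linear isometry `A` and ANY scalar profile `c`; hence
* ★ `sum_radial_smul_eq_zero_of_isometries` / `sum_radial_smul_eq_zero_of_neg_mem` — `Σ_{w∈W} (c ‖w‖²) • w = 0` for a window permuted by linear isometries with trivial
  joint fixed space, resp. an inversion-symmetric window (the LJ force is `c t = t⁻¹^4 - t⁻¹^7`, cf. NODE-10 `…ForceRemainder`).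
[folklore: equivariant sums over symmetric finite sets vanish]
-/

namespace Summit.AtomisticToContinuum.Crystallization.Theorems.FrustratedLawDichotomyWindowSymmetry

open Finset

section Permute

variable {α M : Type*} [DecidableEq α] [AddCommMonoid M]

/-- A self-map sending a finset into itself injectively permutes it. [folklore] -/
theorem image_eq_of_mapsTo_injOn (W : Finset α) (A : α → α) (hA : ∀ w ∈ W, A w ∈ W) (hinj : Set.InjOn A W) : W.image A = W :=
  eq_of_subset_of_card_le (image_subset_iff.mpr hA) (by rw [card_image_of_injOn hinj])

/-- Re-indexing a finite sum along such a permutation. [folklore] -/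
theorem sum_comp_eq_sum_of_mapsTo_injOn (W : Finset α) (A : α → α) (hA : ∀ w ∈ W, A w ∈ W) (hinj : Set.InjOn A W) (f : α → M) :
    ∑ w ∈ W, f (A w) = ∑ w ∈ W, f w := by
  rw [← sum_image hinj, image_eq_of_mapsTo_injOn W A hA hinj]

end Permute

section Equivariant

variable {V : Type*} [AddCommGroup V] [DecidableEq V]

/-- ★ Equivariant sums over symmetric windows vanish: a family of additive self-maps `A i` each permuting `W`, `g` equivariant on `W`, trivial joint fixed space ⇒ `Σ_W g = 0`. [folklore] -/
theorem sum_eq_zero_of_equivariant_family {ι : Type*} (W : Finset V) (A : ι → V →+ V) (g : V → V)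
    (hA : ∀ i, ∀ w ∈ W, A i w ∈ W) (hinj : ∀ i, Set.InjOn (A i) W)
    (hg : ∀ i, ∀ w ∈ W, g (A i w) = A i (g w))
    (hfix : ∀ v : V, (∀ i, A i v = v) → v = 0) :
    ∑ w ∈ W, g w = 0 := by
  apply hfix
  intro i
  rw [map_sum]
  calc ∑ w ∈ W, A i (g w) = ∑ w ∈ W, g (A i w) := sum_congr rfl fun w hw => (hg i w hw).symm
    _ = ∑ w ∈ W, g w := sum_comp_eq_sum_of_mapsTo_injOn W (A i) (hA i) (hinj i) g

end Equivariant

section RealInversion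

variable {V : Type*} [AddCommGroup V] [Module ℝ V]

/-- In a real vector space `-v = v` forces `v = 0`. [folklore] -/
theorem eq_zero_of_neg_eq_self {v : V} (h : -v = v) : v = 0 := by
  have h2 : (2 : ℝ) • v = 0 := by rw [two_smul]; nth_rw 1 [← h]; exact neg_add_cancel v
  exact (smul_eq_zero.mp h2).resolve_left two_ne_zero

variable [DecidableEq V]

/-- Inversion case: `W = -W` and `g` odd on `W` ⇒ `Σ_W g = 0`. [folklore] -/
theorem sum_eq_zero_of_neg_mem (W : Finset V) (g : V → V) (hW : ∀ w ∈ W, -w ∈ W) (hg : ∀ w ∈ W, g (-w) = -g w) :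
    ∑ w ∈ W, g w = 0 := by
  refine sum_eq_zero_of_equivariant_family (ι := Unit) W (fun _ => -AddMonoidHom.id V) g (fun _ w hw => by simpa using hW w hw)
    (fun _ => fun x _ y _ hxy => by simpa using hxy) (fun _ w hw => by simpa using hg w hw) ?_
  intro v hv
  exact eq_zero_of_neg_eq_self (by simpa using hv ())

end RealInversion

section Radial

variable {V : Type*} [NormedAddCommGroup V] [InnerProductSpace ℝ V]

/-- Radial vector fields `x ↦ (c ‖x‖²) • x` are equivariant under linear isometries. [folklore] -/
theorem radial_smul_equivariant (A : V →ₗᵢ[ℝ] V) (c : ℝ → ℝ) (x : V) : (c (‖A x‖ ^ 2)) • A x = A ((c (‖x‖ ^ 2)) • x) := by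
  rw [A.norm_map, A.map_smul]

/-- … and odd. [folklore] -/
theorem radial_smul_neg (c : ℝ → ℝ) (x : V) : (c (‖-x‖ ^ 2)) • (-x) = -((c (‖x‖ ^ 2)) • x) := by
  rw [norm_neg, smul_neg]

variable [DecidableEq V]

/-- ★ Host-window equilibrium, point-group form (hcp: `C₃` and `σ_h` suffice): a finite window permuted by linear isometries with trivial joint fixed space carries zero
radial force sum, for ANY scalar profile `c` (LJ: `c t = t⁻¹^4 - t⁻¹^7`). [folklore] -/
theorem sum_radial_smul_eq_zero_of_isometries {ι : Type*} (W : Finset V) (A : ι → V →ₗᵢ[ℝ] V) (c : ℝ → ℝ)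
    (hA : ∀ i, ∀ w ∈ W, A i w ∈ W) (hfix : ∀ v : V, (∀ i, A i v = v) → v = 0) :
    ∑ w ∈ W, (c (‖w‖ ^ 2)) • w = 0 := by
  refine sum_eq_zero_of_equivariant_family W (fun i => (A i).toLinearMap.toAddMonoidHom) (fun w => (c (‖w‖ ^ 2)) • w)
    (fun i w hw => by simpa using hA i w hw) (fun i => fun x _ y _ hxy => (A i).injective (by simpa using hxy))
    (fun i w _ => by simp) ?_
  intro v hv
  exact hfix v fun i => by simpa using hv i

/-- ★ Host-window equilibrium, inversion form (any Bravais host, e.g. fcc: the ball window is `-W = W`). [folklore] -/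
theorem sum_radial_smul_eq_zero_of_neg_mem (W : Finset V) (c : ℝ → ℝ) (hW : ∀ w ∈ W, -w ∈ W) :
    ∑ w ∈ W, (c (‖w‖ ^ 2)) • w = 0 :=
  sum_eq_zero_of_neg_mem W _ hW fun w _ => radial_smul_neg c w

/-- The LJ instance used by T2 (profile of NODE-10): `Σ_{w ∈ W} ((‖w‖²)⁻¹^4 - (‖w‖²)⁻¹^7) • w = 0` on an inversion-symmetric window. [folklore] -/
theorem sum_ljForce_eq_zero_of_neg_mem (W : Finset V) (hW : ∀ w ∈ W, -w ∈ W) :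
    ∑ w ∈ W, ((‖w‖ ^ 2)⁻¹ ^ 4 - (‖w‖ ^ 2)⁻¹ ^ 7) • w = 0 :=
  sum_radial_smul_eq_zero_of_neg_mem W (fun t => t⁻¹ ^ 4 - t⁻¹ ^ 7) hW

end Radial

end Summit.AtomisticToContinuum.Crystallization.Theorems.FrustratedLawDichotomyWindowSymmetry
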